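import Summits.NavierStokesRegularity.NavierStokesRegularity.Theorems.TypeIQuarterGateQuarterLawEventual
import Summits.NavierStokesRegularity.NavierStokesRegularity.Theorems.TypeICertificateLadderTargetStrainCubeSharpDepletion
import Summits.NavierStokesRegularity.NavierStokesRegularity.Theorems.TypeICertificateLadderTargetLogisticEnstrophyApriori
import Literature.Analysis.FluidPDE.BKMClassGradientContinuity
import HarnessLib

/-!
# `TypeIQuarterGate`: the ENSTROPHY EXPONENT WINDOW of a Type-I blow-up (crux `QuarterLawTypeI`, 23726)

`--supports stmt-NavierStokesRegularity-23726` (helper; the registered line `lorentz-upgrade` is at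
its fixed point — its one open stub `stub_lorentzUpgrade` = `LorentzUpgradeTypeI` ⟺ `QuarterLawTypeI`,
tree `LorentzOfEnvelope.lorentzUpgradeTypeI_iff_quarterLawTypeI` — so this file quantifies the crux
itself instead).

The crux K1 = `QuarterLawTypeI` asks, along a maximal classical Leray–Hopf solution from a rapidly
decaying datum with the sup-norm Type-I rate at `T`, for Leray's UPPER quarter rate
`Z(t) := ∫‖curl u(t)‖² ≤ K (T−t)^{−1/2}` on `[0,T)`.  Write the rate in the dimensionless currency of
the certificate ladder, `√(T−t)‖u(t,x)‖ ≤ C√ν` eventually (`exists_rate_of_isTypeIBlowup`: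
`IsTypeIBlowup` always supplies such a `C ≥ 0`), and let `κ := (2+√3)/9 = 0.4147…` be the tree's sharp
strain-cube depletion constant (`StrainCube.abs_integral_stretching_le_strainCube_sharp`).  This file
proves, BY NAME and in K1's own currency (`∫⁻ ‖curl (u t) x‖ₑ²`, all `t ∈ [0,T)`):

* `enstrophyCapTypeI` — **exponent `1` for every `C`**: under K1's hypotheses VERBATIM,
  `∃ K, ∀ t ∈ [0,T), Z(t) ≤ K/(T−t)`.  (The tree's logistic Type-I cap
  `DepletionLadder.frobeniusNormSq_fderiv_le_of_rate`, `‖∇u(t)‖₂² ≤ K + C²E₀/(2ν(T−t))`, so far unused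
  by any route, moved into curl/`lintegral` currency by `∫⁻|∇u|²_F = ∫⁻‖curl u‖ₑ²` on Tao's class and
  extended to early times by Tao's cover.)
* `lintegral_curl_sq_le_rpow_sharp_of_rate` — **exponent `κ²C²/2`**: `Z(t) ≤ K (T−t)^{−κ²C²/2}` on
  `(0,T)` (the flow-wise depleted enstrophy Grönwall `DepletionLadder.lintegral_curl_sq_le_rpow_of_rate_flowwise`
  fed with the sharp depletion along the solution, `sharpDepletion_along`).
* `quarterLawTypeI_of_rate_le_sharp` — hence **K1's conclusion HOLDS on the stratum `κ·C ≤ 1`**, i.e.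
  `C ≤ 9/(2+√3) = 18 − 9√3 = 2.4115…`, boundary included.  Honest reading
  (`typeI_stratum_below_sharp_empty`): for maximal solutions the OPEN part `κC < 1` of that stratum is
  EMPTY (the ladder's rung `StrainCube.hasSmoothExtensionPast_of_rate_lt_sharp` continues the solution),
  so the only non-vacuous case settled here is the boundary rung `κC = 1`, where the depleted Grönwall
  exponent is exactly `1/2`.
* `quarterLawTypeI_iff_large_constants` — **REDUCTION**: `QuarterLawTypeI` ⟺ the same statement for
  Type-I blow-ups with dimensionless constant `C > 9/(2+√3)` only.

So the enstrophy exponent of a (hypothetical) sup-norm Type-I blow-up lies in the WINDOW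
`a(C) ≤ min(1, κ²C²/2)` unconditionally, Leray's lower bound pins `a ≥ 1/2` at a genuine blow-up
(tree `leray_blowup_rate_top_holds` / `RungReynoldsOne.stub_h1BlowupRate`), and the crux 23726 is
EXACTLY the statement `a(C) = 1/2` for all `C > 2.4115`: lowering the exponent from `min(1, κ²C²/2)` to
`1/2`.  Repair-census wording: the missing lemma is an a-priori bound
`Z(t)·√(T−t) ≤ K` for `C > 18 − 9√3`, equivalently (p818591) a uniform weak-`L³` bound, equivalently
(p816056) the scale-uniform ε-concentration count; no depletion CONSTANT can give it
(`StrainCube.constantForm_rung_ceiling`).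

HONEST FRAMING: compositions of tree theorems along a HYPOTHETICAL blow-up; `QuarterLawTypeI`,
`LorentzUpgradeTypeI`, `UniformConcentrationCountTypeI` remain OPEN; nothing about Navier–Stokes
regularity is claimed. [folklore]
-/

-- the problem directory repeats the summit name (`NavierStokesRegularity/NavierStokesRegularity`)
set_option linter.dupNamespace false

noncomputable section

open Set Filter Topology MeasureTheory
open scoped RealInnerProductSpace ENNReal NNReal ContDiff

namespace Summit.NavierStokesRegularity.NavierStokesRegularity.Theorems

namespace QuarterLawExponent

open Literature.Analysis.FluidPDE
open Summit.NavierStokesRegularity.NavierStokesRegularity.Theorems.RungReynoldsOne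
  (stub_taoCover enorm_curl_sq_le_six_mul)
open Summit.NavierStokesRegularity.NavierStokesRegularity.Theorems.DepletionLadder
  (frobeniusNormSq_fderiv_le_of_rate lintegral_curl_sq_le_rpow_of_rate_flowwise)
open Summit.NavierStokesRegularity.NavierStokesRegularity.Theorems.DepletionLadder.StrainCube
  (abs_integral_stretching_le_strainCube_sharp hasSmoothExtensionPast_of_rate_lt_sharp)

/-! ### The rate currency -/

/-- The tree predicate `IsTypeIBlowup u T` (`∃ C, ∀ᶠ t ↑ T, ∀ x, ‖u t x‖ ≤ C/√(T−t)`) in the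
dimensionless-rate currency of the certificate ladder: `√(T−t)‖u(t,x)‖ ≤ C' √ν` eventually, with
some `C' ≥ 0` (namely `max C 0/√ν`). [folklore] -/
theorem exists_rate_of_isTypeIBlowup {ν T : ℝ} (hν : 0 < ν)
    {u : ℝ → EuclideanSpace ℝ (Fin 3) → EuclideanSpace ℝ (Fin 3)} (hI : IsTypeIBlowup u T) :
    ∃ C : ℝ, 0 ≤ C ∧ ∀ᶠ t in 𝓝[<] T, ∀ x, Real.sqrt (T - t) * ‖u t x‖ ≤ C * Real.sqrt ν := by
  obtain ⟨C, hC⟩ := hI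
  have hsν : 0 < Real.sqrt ν := Real.sqrt_pos.2 hν
  refine ⟨max C 0 / Real.sqrt ν, by positivity, ?_⟩
  have hlt : ∀ᶠ t in 𝓝[<] T, t < T := eventually_nhdsWithin_of_forall fun t ht => ht
  filter_upwards [hC, hlt] with t ht htT x
  have hst : 0 < Real.sqrt (T - t) := Real.sqrt_pos.2 (sub_pos.2 htT)
  rw [div_mul_cancel₀ _ hsν.ne']
  have h1 : ‖u t x‖ ≤ max C 0 / Real.sqrt (T - t) :=
    (ht x).trans (div_le_div_of_nonneg_right (le_max_left _ _) hst.le)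
  rw [le_div_iff₀ hst] at h1
  calc Real.sqrt (T - t) * ‖u t x‖ = ‖u t x‖ * Real.sqrt (T - t) := mul_comm _ _
    _ ≤ max C 0 := h1

/-- Conversely, a dimensionless rate gives the tree predicate `IsTypeIBlowup u T` (constant `C√ν`).
[folklore] -/
theorem isTypeIBlowup_of_rate {ν T C : ℝ}
    {u : ℝ → EuclideanSpace ℝ (Fin 3) → EuclideanSpace ℝ (Fin 3)}
    (hrate : ∀ᶠ t in 𝓝[<] T, ∀ x, Real.sqrt (T - t) * ‖u t x‖ ≤ C * Real.sqrt ν) :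
    IsTypeIBlowup u T := by
  refine ⟨C * Real.sqrt ν, ?_⟩
  have hlt : ∀ᶠ t in 𝓝[<] T, t < T := eventually_nhdsWithin_of_forall fun t ht => ht
  filter_upwards [hrate, hlt] with t ht htT x
  have hst : 0 < Real.sqrt (T - t) := Real.sqrt_pos.2 (sub_pos.2 htT)
  rw [le_div_iff₀ hst, mul_comm]
  exact ht x

/-! ### The sharp depletion inequality holds along the flow -/

/-- The sharp strain-cube depletion `|∫⟪ω, Du ω⟫| ≤ ((2+√3)/9)·M·‖ω‖₂·‖∇ω‖₂` (`M` any sup bound of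
`u(t)`) holds ALONG every classical Leray–Hopf rapidly-decaying-datum solution on `[0,T)`: Tao's
class on the closed sub-slab `[0,(t+T)/2]` supplies the `L²` Sobolev side conditions and a gradient
bound (verbatim the feed inside `StrainCube.hasSmoothExtensionPast_of_rate_lt_sharp`). [folklore] -/
theorem sharpDepletion_along {ν T : ℝ} (hν : 0 < ν) (hT : 0 < T)
    {u : ℝ → EuclideanSpace ℝ (Fin 3) → EuclideanSpace ℝ (Fin 3)}
    {p : ℝ → EuclideanSpace ℝ (Fin 3) → ℝ}
    (hsol : IsClassicalNSSolutionOn (Ico 0 T) ν 0 u p) (hLH : IsLerayHopfOn T ν 0 (u 0) u)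
    (hdec : HasRapidSpatialDecay (u 0)) :
    ∀ t ∈ Ico 0 T, ∀ M : ℝ, (∀ x, ‖u t x‖ ≤ M) →
      |∫ x, ⟪curl (u t) x, fderiv ℝ (u t) x (curl (u t) x)⟫| ≤
        (2 + Real.sqrt 3) / 9 * M * Real.sqrt (∫ x, ‖curl (u t) x‖ ^ 2) *
          Real.sqrt (∫ x, frobeniusNormSq (fderiv ℝ (curl (u t)) x)) := by
  intro t ht M hM
  have ht' : (t + T) / 2 ∈ Ioo 0 T := ⟨by linarith [ht.1], by linarith [ht.2]⟩
  obtain ⟨q, hsolt, hut, -, -⟩ := stub_taoCover hν hT hsol hLH hdec ht'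
  have htI : t ∈ Icc 0 ((t + T) / 2) := ⟨ht.1, by linarith [ht.2]⟩
  obtain ⟨C₀, hC₀⟩ := hut 0
  obtain ⟨C₁, hC₁⟩ := hut 1
  obtain ⟨C₂, hC₂⟩ := hut 2
  obtain ⟨B₁, -, hB₁⟩ := exists_forall_norm_fderiv_le_of_hasBoundedSobolevNormsOn
    (fun s hs => (hsolt.contDiff_velocity hs).of_le (by norm_cast)) hut
  have h0 : ∫⁻ x, ‖iteratedFDeriv ℝ 0 (u t) x‖ₑ ^ 2 < ⊤ := (hC₀ t htI).trans_lt ENNReal.coe_lt_top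
  have h1 : ∫⁻ x, ‖iteratedFDeriv ℝ 1 (u t) x‖ₑ ^ 2 < ⊤ := (hC₁ t htI).trans_lt ENNReal.coe_lt_top
  have h2 : ∫⁻ x, ‖iteratedFDeriv ℝ 2 (u t) x‖ₑ ^ 2 < ⊤ := (hC₂ t htI).trans_lt ENNReal.coe_lt_top
  have hv : ContDiff ℝ ∞ (u t) := hsol.contDiff_velocity ht
  have hdiv : VectorCalculus.IsDivFree (u t) := hsol.divFree t ht
  exact abs_integral_stretching_le_strainCube_sharp hv hdiv hM (hB₁ t htI) h0 h1 h2

/-! ### Exponent `κ²C²/2`: the depleted Grönwall with the sharp constant -/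

/-- **Polynomial enstrophy law under the rate, sharp depletion exponent.** Along a classical
Leray–Hopf rapidly-decaying-datum solution on `[0,T)` with eventual dimensionless rate
`√(T−t)‖u(t,x)‖ ≤ C√ν`: `∫‖curl u(t)‖² ≤ K (T−t)^{−κ²C²/2}` on `(0,T)`, `κ = (2+√3)/9`.
[folklore] -/
theorem lintegral_curl_sq_le_rpow_sharp_of_rate {ν T C : ℝ} (hν : 0 < ν) (hT : 0 < T)
    {u : ℝ → EuclideanSpace ℝ (Fin 3) → EuclideanSpace ℝ (Fin 3)}
    {p : ℝ → EuclideanSpace ℝ (Fin 3) → ℝ}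
    (hsol : IsClassicalNSSolutionOn (Ico 0 T) ν 0 u p) (hLH : IsLerayHopfOn T ν 0 (u 0) u)
    (hdec : HasRapidSpatialDecay (u 0))
    (hrate : ∀ᶠ t in 𝓝[<] T, ∀ x, Real.sqrt (T - t) * ‖u t x‖ ≤ C * Real.sqrt ν) :
    ∃ K : ℝ, 0 ≤ K ∧ ∀ t ∈ Ioo 0 T,
      ∫⁻ x, ‖curl (u t) x‖ₑ ^ 2 ≤
        ENNReal.ofReal (K * (T - t) ^ (-(((2 + Real.sqrt 3) / 9) ^ 2 * C ^ 2 / 2))) :=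
  lintegral_curl_sq_le_rpow_of_rate_flowwise hν hT hsol hLH hdec
    (sharpDepletion_along hν hT hsol hLH hdec) hrate

/-! ### Exponent `1`: the logistic Type-I cap in curl currency -/

/-- **The Type-I enstrophy cap, curl/`lintegral` currency, final window.** Along a classical
Leray–Hopf rapidly-decaying-datum solution on `[0,T)` with eventual rate `√(T−t)‖u(t,x)‖ ≤ C√ν`
(any `C`): `∫⁻‖curl u(t)‖ₑ² ≤ K/(T−t)` on some `[t₀,T)`, with
`K = K₁T + C²·2E(u₀)/(4ν)` from the tree cap `‖∇u(t)‖₂² ≤ K₁ + C²·2E(u₀)/(4ν(T−t))`. [folklore] -/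
theorem lintegral_curl_sq_le_inv_eventually_of_rate {ν T C : ℝ} (hν : 0 < ν) (hT : 0 < T)
    {u : ℝ → EuclideanSpace ℝ (Fin 3) → EuclideanSpace ℝ (Fin 3)}
    {p : ℝ → EuclideanSpace ℝ (Fin 3) → ℝ}
    (hsol : IsClassicalNSSolutionOn (Ico 0 T) ν 0 u p) (hLH : IsLerayHopfOn T ν 0 (u 0) u)
    (hdec : HasRapidSpatialDecay (u 0))
    (hrate : ∀ᶠ t in 𝓝[<] T, ∀ x, Real.sqrt (T - t) * ‖u t x‖ ≤ C * Real.sqrt ν) :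
    ∃ K t₀ : ℝ, 0 ≤ K ∧ t₀ < T ∧ ∀ t ∈ Ico t₀ T,
      ∫⁻ x, ‖curl (u t) x‖ₑ ^ 2 ≤ ENNReal.ofReal (K / (T - t)) := by
  obtain ⟨K₁, hK₁, t₀, ht₀, hcap⟩ := frobeniusNormSq_fderiv_le_of_rate hν hT hsol hLH hdec hrate
  set E₀ : ℝ := 2 * VectorCalculus.kineticEnergy (u 0) with hE₀
  have hE₀0 : 0 ≤ E₀ := mul_nonneg zero_le_two (kineticEnergy_nonneg _)
  refine ⟨K₁ * T + C ^ 2 * E₀ / (4 * ν), t₀, by positivity, ht₀.2, fun t ht => ?_⟩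
  have ht0T : t ∈ Ico 0 T := ⟨ht₀.1.le.trans ht.1, ht.2⟩
  have hTt : 0 < T - t := sub_pos.2 ht.2
  -- the real bound `∫ |∇u(t)|²_F ≤ (K₁ T + C² E₀/(4ν)) / (T − t)`
  have hreal : ∫ x, frobeniusNormSq (fderiv ℝ (u t) x) ≤
      (K₁ * T + C ^ 2 * E₀ / (4 * ν)) / (T - t) := by
    have h1 : K₁ ≤ K₁ * T / (T - t) := by
      rw [le_div_iff₀ hTt]; nlinarith [ht0T.1]
    have h2 : C ^ 2 * E₀ / (4 * ν * (T - t)) = C ^ 2 * E₀ / (4 * ν) / (T - t) := by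
      rw [div_div]
    calc ∫ x, frobeniusNormSq (fderiv ℝ (u t) x) ≤ K₁ + C ^ 2 * E₀ / (4 * ν * (T - t)) := hcap t ht
      _ ≤ K₁ * T / (T - t) + C ^ 2 * E₀ / (4 * ν) / (T - t) := by rw [h2]; linarith
      _ = (K₁ * T + C ^ 2 * E₀ / (4 * ν)) / (T - t) := by rw [add_div]
  -- Tao's class on `[0,(t+T)/2]`: `u(t), Du(t), D²u(t) ∈ L²`, so `∫⁻|∇u(t)|²_F = ∫⁻‖curl u(t)‖ₑ²`
  have ht' : (t + T) / 2 ∈ Ioo 0 T := ⟨by linarith [ht0T.1], by linarith [ht.2]⟩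
  obtain ⟨q, -, hut, -, -⟩ := stub_taoCover hν hT hsol hLH hdec ht'
  have htI : t ∈ Icc 0 ((t + T) / 2) := ⟨ht0T.1, by linarith [ht.2]⟩
  have hn : ∀ n : ℕ, ∫⁻ x, ‖iteratedFDeriv ℝ n (u t) x‖ₑ ^ 2 < ⊤ := fun n => by
    obtain ⟨Cn, hCn⟩ := hut n
    exact (hCn t htI).trans_lt ENNReal.coe_lt_top
  have h0 : ∫⁻ x, ‖u t x‖ₑ ^ 2 < ⊤ := by
    refine lt_of_le_of_lt (le_of_eq (lintegral_congr fun x => ?_)) (hn 0)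
    rw [← ofReal_norm, ← norm_iteratedFDeriv_zero (𝕜 := ℝ) (f := u t), ofReal_norm]
  have hsm : ContDiff ℝ 2 (u t) := (hsol.contDiff_velocity ht0T).of_le (by norm_cast)
  have hid := lintegral_frobeniusNormSq_fderiv_eq_lintegral_curl_sq hsm (hsol.divFree t ht0T)
    h0 (hn 1) (hn 2)
  -- integrability of the Frobenius density (finite: `‖curl‖ₑ² ≤ 6‖Du‖ₑ²`)
  have hfin : ∫⁻ x, ENNReal.ofReal (frobeniusNormSq (fderiv ℝ (u t) x)) < ⊤ := by
    rw [hid]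
    refine lt_of_le_of_lt (lintegral_mono fun x => enorm_curl_sq_le_six_mul (u t) x) ?_
    rw [lintegral_const_mul' _ _ (by norm_num)]
    exact ENNReal.mul_lt_top (by norm_num) (hn 1)
  have hcont : Continuous fun x => frobeniusNormSq (fderiv ℝ (u t) x) :=
    continuous_frobeniusNormSq_fderiv hsm (by norm_num)
  have hint : Integrable (fun x => frobeniusNormSq (fderiv ℝ (u t) x)) := by
    refine ⟨hcont.aestronglyMeasurable, (hasFiniteIntegral_iff_enorm).2 ?_⟩
    refine lt_of_le_of_lt (le_of_eq (lintegral_congr fun x => ?_)) hfin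
    rw [Real.enorm_eq_ofReal (frobeniusNormSq_nonneg _)]
  rw [← hid, ← ofReal_integral_eq_lintegral_ofReal hint
    (ae_of_all _ fun x => frobeniusNormSq_nonneg _)]
  exact ENNReal.ofReal_le_ofReal hreal

/-- **Early times are free (weight `1/(T−t)`).** For a classical Leray–Hopf rapidly-decaying-datum
solution on `[0,T)`, a bound `∫⁻‖curl u(t)‖ₑ² ≤ K/(T−t)` on a final window `[t₀,T)` extends to
`[0,T)` (Tao's class on `[0,t₀]`: `Z ≤ 6C₁ ≤ 6C₁T/(T−t)`). [folklore] -/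
theorem lintegral_curl_sq_le_inv_of_eventually {ν T : ℝ} (hν : 0 < ν) (hT : 0 < T)
    {u : ℝ → EuclideanSpace ℝ (Fin 3) → EuclideanSpace ℝ (Fin 3)}
    {p : ℝ → EuclideanSpace ℝ (Fin 3) → ℝ}
    (hsol : IsClassicalNSSolutionOn (Ico 0 T) ν 0 u p) (hLH : IsLerayHopfOn T ν 0 (u 0) u)
    (hdec : HasRapidSpatialDecay (u 0))
    (hev : ∃ K t₀ : ℝ, t₀ < T ∧ ∀ t ∈ Ico t₀ T,
      ∫⁻ x, ‖curl (u t) x‖ₑ ^ 2 ≤ ENNReal.ofReal (K / (T - t))) :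
    ∃ K : ℝ, ∀ t ∈ Ico 0 T,
      ∫⁻ x, ‖curl (u t) x‖ₑ ^ 2 ≤ ENNReal.ofReal (K / (T - t)) := by
  obtain ⟨K, t₀, ht₀T, hK⟩ := hev
  rcases le_or_gt t₀ 0 with ht₀ | ht₀
  · exact ⟨K, fun t ht => hK t ⟨ht₀.trans ht.1, ht.2⟩⟩
  obtain ⟨q, -, hB, -, -⟩ := stub_taoCover hν hT hsol hLH hdec ⟨ht₀, ht₀T⟩
  obtain ⟨C₁, hC₁⟩ := hB 1
  set Z₀ : ℝ := 6 * (C₁ : ℝ) with hZ₀_def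
  have hZ₀ : 0 ≤ Z₀ := by positivity
  refine ⟨max K (Z₀ * T), fun t ht => ?_⟩
  have hTt : 0 < T - t := by linarith [ht.2]
  rcases lt_or_ge t t₀ with htt₀ | htt₀
  · have h2 : ∫⁻ x, ‖iteratedFDeriv ℝ 1 (u t) x‖ₑ ^ 2 ≤ C₁ := hC₁ t ⟨ht.1, htt₀.le⟩
    have h3 : ∫⁻ x, ‖curl (u t) x‖ₑ ^ 2 ≤ ENNReal.ofReal Z₀ := by
      refine (lintegral_mono fun x => enorm_curl_sq_le_six_mul (u t) x).trans ?_
      rw [lintegral_const_mul' _ _ (by norm_num), hZ₀_def, ENNReal.ofReal_mul (by norm_num),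
        ENNReal.ofReal_coe_nnreal, show ENNReal.ofReal 6 = 6 by norm_num]
      exact mul_le_mul' le_rfl h2
    refine h3.trans (ENNReal.ofReal_le_ofReal ?_)
    rw [le_div_iff₀ hTt]
    calc Z₀ * (T - t) ≤ Z₀ * T := mul_le_mul_of_nonneg_left (by linarith [ht.1]) hZ₀
      _ ≤ max K (Z₀ * T) := le_max_right _ _
  · refine (hK t ⟨htt₀, ht.2⟩).trans (ENNReal.ofReal_le_ofReal ?_)
    exact div_le_div_of_nonneg_right (le_max_left _ _) hTt.le

/-! ### The quarter law on the stratum `κ·C ≤ 1` -/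

/-- **Leray's upper quarter rate on the stratum `κC ≤ 1`.** Along a classical Leray–Hopf
rapidly-decaying-datum solution on `[0,T)` with eventual dimensionless rate `√(T−t)‖u(t,x)‖ ≤ C√ν`,
`0 ≤ C`, `((2+√3)/9)·C ≤ 1` (`C ≤ 18 − 9√3 = 2.4115…`): `∫‖curl u(t)‖² ≤ K/√(T−t)` on `[0,T)`
(exponent `κ²C²/2 ≤ 1/2`, then `(T−t)^{1/2−κ²C²/2} ≤ max T 1`, then early times by Tao's class).
[folklore] -/
theorem quarterLaw_of_rate_le_sharp {ν T C : ℝ} (hν : 0 < ν) (hT : 0 < T)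
    {u : ℝ → EuclideanSpace ℝ (Fin 3) → EuclideanSpace ℝ (Fin 3)}
    {p : ℝ → EuclideanSpace ℝ (Fin 3) → ℝ}
    (hsol : IsClassicalNSSolutionOn (Ico 0 T) ν 0 u p) (hLH : IsLerayHopfOn T ν 0 (u 0) u)
    (hdec : HasRapidSpatialDecay (u 0))
    (hrate : ∀ᶠ t in 𝓝[<] T, ∀ x, Real.sqrt (T - t) * ‖u t x‖ ≤ C * Real.sqrt ν)
    (hC0 : 0 ≤ C) (hκC : (2 + Real.sqrt 3) / 9 * C ≤ 1) :
    ∃ K : ℝ, ∀ t ∈ Ico 0 T,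
      ∫⁻ x, ‖curl (u t) x‖ₑ ^ 2 ≤ ENNReal.ofReal (K / Real.sqrt (T - t)) := by
  obtain ⟨K, hK0, hK⟩ := lintegral_curl_sq_le_rpow_sharp_of_rate hν hT hsol hLH hdec hrate
  set a : ℝ := ((2 + Real.sqrt 3) / 9) ^ 2 * C ^ 2 / 2 with ha_def
  have hκC0 : 0 ≤ (2 + Real.sqrt 3) / 9 * C := by positivity
  have ha : a ≤ 1 / 2 := by
    have h1 : ((2 + Real.sqrt 3) / 9 * C) ^ 2 ≤ 1 := pow_le_one₀ hκC0 hκC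
    rw [ha_def, ← mul_pow]; linarith
  have ha0 : 0 ≤ a := by positivity
  set M : ℝ := max T 1 with hM_def
  have hM0 : 0 ≤ M := le_trans zero_le_one (le_max_right _ _)
  have key : ∀ t ∈ Ioo 0 T,
      ∫⁻ x, ‖curl (u t) x‖ₑ ^ 2 ≤ ENNReal.ofReal (K * M / Real.sqrt (T - t)) := by
    intro t ht
    have hTt : 0 < T - t := sub_pos.2 ht.2
    refine (hK t ht).trans (ENNReal.ofReal_le_ofReal ?_)
    have hsplit : (T - t) ^ (-a) = (T - t) ^ (1 / 2 - a) * (Real.sqrt (T - t))⁻¹ := by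
      rw [Real.sqrt_eq_rpow, ← Real.rpow_neg hTt.le, ← Real.rpow_add hTt]
      congr 1; ring
    have hpow : (T - t) ^ (1 / 2 - a) ≤ M := by
      rcases le_or_gt (T - t) 1 with h1 | h1
      · exact (Real.rpow_le_one hTt.le h1 (by linarith)).trans (le_max_right _ _)
      · calc (T - t) ^ (1 / 2 - a) ≤ (T - t) ^ (1 : ℝ) :=
              Real.rpow_le_rpow_of_exponent_le h1.le (by linarith)
          _ = T - t := Real.rpow_one _
          _ ≤ M := by linarith [ht.1, le_max_left T 1]
    have hinv : 0 ≤ (Real.sqrt (T - t))⁻¹ := inv_nonneg.2 (Real.sqrt_nonneg _)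
    rw [hsplit, div_eq_mul_inv]
    calc K * ((T - t) ^ (1 / 2 - a) * (Real.sqrt (T - t))⁻¹)
        = K * (T - t) ^ (1 / 2 - a) * (Real.sqrt (T - t))⁻¹ := by ring
      _ ≤ K * M * (Real.sqrt (T - t))⁻¹ := by gcongr
  exact LorentzOfEnvelope.quarterLaw_of_eventually hν hT hsol hLH hdec
    ⟨K * M, T / 2, by linarith, fun t ht => key t ⟨by linarith [ht.1], ht.2⟩⟩

/-! ### By name, in the hypothesis shape of `QuarterLawTypeI` (stmt-23726) -/

open Summit.NavierStokesRegularity.NavierStokesRegularity.Theses.TypeIQuarterGate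

/-- **THE TYPE-I ENSTROPHY CAP (exponent `1`) under K1's hypotheses verbatim.** A maximal classical
Leray–Hopf solution on `ℝ³×[0,T)` from a rapidly decaying datum with the sup-norm Type-I rate at `T`
has `∫‖curl u(t)‖² ≤ K/(T−t)` on `[0,T)`.  The crux `QuarterLawTypeI` asks for `K/√(T−t)`: the
open content of 23726 is exactly the exponent gap `1 ↦ 1/2`. [folklore] -/
theorem enstrophyCapTypeI :
    ∀ (ν T : ℝ), 0 < ν → 0 < T →
      ∀ (u : ℝ → EuclideanSpace ℝ (Fin 3) → EuclideanSpace ℝ (Fin 3))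
        (p : ℝ → EuclideanSpace ℝ (Fin 3) → ℝ),
        IsMaximalSmoothSolution ν 0 u p T → IsLerayHopfOn T ν 0 (u 0) u →
        HasRapidSpatialDecay (u 0) → IsTypeIBlowup u T →
        ∃ K : ℝ, ∀ t ∈ Ico 0 T,
          ∫⁻ x, ‖curl (u t) x‖ₑ ^ 2 ≤ ENNReal.ofReal (K / (T - t)) := by
  intro ν T hν hT u p hmax hLH hdec hI
  obtain ⟨C, -, hrate⟩ := exists_rate_of_isTypeIBlowup hν hI
  obtain ⟨K, t₀, -, ht₀T, hK⟩ :=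
    lintegral_curl_sq_le_inv_eventually_of_rate hν hT hmax.1 hLH hdec hrate
  exact lintegral_curl_sq_le_inv_of_eventually hν hT hmax.1 hLH hdec ⟨K, t₀, ht₀T, hK⟩

/-- **`QuarterLawTypeI` ON THE STRATUM `C ≤ 18 − 9√3 = 2.4115…`** (dimensionless Type-I constant,
boundary included): K1's conclusion holds for every maximal classical Leray–Hopf solution from a
rapidly decaying datum whose eventual rate constant satisfies `((2+√3)/9)·C ≤ 1`.  (Below the boundary
the stratum is empty, `typeI_stratum_below_sharp_empty`; the boundary rung is the non-vacuous case.)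
[folklore] -/
theorem quarterLawTypeI_of_rate_le_sharp :
    ∀ (ν T : ℝ), 0 < ν → 0 < T →
      ∀ (u : ℝ → EuclideanSpace ℝ (Fin 3) → EuclideanSpace ℝ (Fin 3))
        (p : ℝ → EuclideanSpace ℝ (Fin 3) → ℝ),
        IsMaximalSmoothSolution ν 0 u p T → IsLerayHopfOn T ν 0 (u 0) u →
        HasRapidSpatialDecay (u 0) →
        ∀ C : ℝ, 0 ≤ C → (2 + Real.sqrt 3) / 9 * C ≤ 1 →
        (∀ᶠ t in 𝓝[<] T, ∀ x, Real.sqrt (T - t) * ‖u t x‖ ≤ C * Real.sqrt ν) →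
        ∃ K : ℝ, ∀ t ∈ Ico 0 T,
          ∫⁻ x, ‖curl (u t) x‖ₑ ^ 2 ≤ ENNReal.ofReal (K / Real.sqrt (T - t)) :=
  fun _ν _T hν hT _u _p hmax hLH hdec _C hC0 hκC hrate =>
    quarterLaw_of_rate_le_sharp hν hT hmax.1 hLH hdec hrate hC0 hκC

/-- **Honesty clause: the open stratum `κC < 1` is EMPTY for maximal solutions** — the ladder's rung
`StrainCube.hasSmoothExtensionPast_of_rate_lt_sharp` continues such a solution past `T` (for `C ≤ 1`
use the rung at `max C 1`, still below `1/κ = 2.41…`). So `quarterLawTypeI_of_rate_le_sharp` is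
vacuous except at the boundary rung `κC = 1`. [folklore] -/
theorem typeI_stratum_below_sharp_empty :
    ∀ (ν T : ℝ), 0 < ν → 0 < T →
      ∀ (u : ℝ → EuclideanSpace ℝ (Fin 3) → EuclideanSpace ℝ (Fin 3))
        (p : ℝ → EuclideanSpace ℝ (Fin 3) → ℝ),
        IsMaximalSmoothSolution ν 0 u p T → IsLerayHopfOn T ν 0 (u 0) u →
        HasRapidSpatialDecay (u 0) →
        ∀ C : ℝ, (2 + Real.sqrt 3) / 9 * C < 1 →
        (∀ᶠ t in 𝓝[<] T, ∀ x, Real.sqrt (T - t) * ‖u t x‖ ≤ C * Real.sqrt ν) → False := by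
  intro ν T hν hT u p hmax hLH hdec C hκC hrate
  have h3 : Real.sqrt 3 < 1.7321 := by
    rw [Real.sqrt_lt' (by norm_num)]; norm_num
  have hκ1 : (2 + Real.sqrt 3) / 9 * max C 1 < 1 := by
    rcases le_or_gt C 1 with hC1 | hC1
    · rw [max_eq_right hC1]; nlinarith [Real.sqrt_nonneg 3]
    · rw [max_eq_left hC1.le]; exact hκC
  have hrate' : ∀ᶠ t in 𝓝[<] T, ∀ x, Real.sqrt (T - t) * ‖u t x‖ ≤ max C 1 * Real.sqrt ν := by
    filter_upwards [hrate] with t ht x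
    exact (ht x).trans (mul_le_mul_of_nonneg_right (le_max_left _ _) (Real.sqrt_nonneg _))
  exact hmax.2 (hasSmoothExtensionPast_of_rate_lt_sharp hν hT
    (lt_of_lt_of_le one_pos (le_max_right _ _)) hκ1 hmax.1 hLH hdec hrate')

/-- **REDUCTION OF THE CRUX TO LARGE CONSTANTS.** `QuarterLawTypeI` (23726) ⟺ Leray's upper quarter
rate for the Type-I blow-ups of its class whose dimensionless rate constant EXCEEDS
`9/(2+√3) = 18 − 9√3 = 2.4115…` (the reach of the sharp depletion constant); the complementary stratum
is `quarterLawTypeI_of_rate_le_sharp`. [folklore] -/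
theorem quarterLawTypeI_iff_large_constants :
    QuarterLawTypeI ↔
      ∀ (ν T : ℝ), 0 < ν → 0 < T →
        ∀ (u : ℝ → EuclideanSpace ℝ (Fin 3) → EuclideanSpace ℝ (Fin 3))
          (p : ℝ → EuclideanSpace ℝ (Fin 3) → ℝ),
          IsMaximalSmoothSolution ν 0 u p T → IsLerayHopfOn T ν 0 (u 0) u →
          HasRapidSpatialDecay (u 0) →
          ∀ C : ℝ, 9 / (2 + Real.sqrt 3) < C →
          (∀ᶠ t in 𝓝[<] T, ∀ x, Real.sqrt (T - t) * ‖u t x‖ ≤ C * Real.sqrt ν) →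
          ∃ K : ℝ, ∀ t ∈ Ico 0 T,
            ∫⁻ x, ‖curl (u t) x‖ₑ ^ 2 ≤ ENNReal.ofReal (K / Real.sqrt (T - t)) := by
  constructor
  · intro h ν T hν hT u p hmax hLH hdec C _hC hrate
    exact h ν T hν hT u p hmax hLH hdec (isTypeIBlowup_of_rate hrate)
  · intro h ν T hν hT u p hmax hLH hdec hI
    obtain ⟨C, hC0, hrate⟩ := exists_rate_of_isTypeIBlowup hν hI
    rcases le_or_gt ((2 + Real.sqrt 3) / 9 * C) 1 with hκC | hκC
    · exact quarterLaw_of_rate_le_sharp hν hT hmax.1 hLH hdec hrate hC0 hκC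
    · refine h ν T hν hT u p hmax hLH hdec C ?_ hrate
      have hpos : (0 : ℝ) < 2 + Real.sqrt 3 := by positivity
      rw [div_lt_iff₀ hpos]
      have h9 : 9 * 1 < 9 * ((2 + Real.sqrt 3) / 9 * C) := by nlinarith
      calc (9 : ℝ) = 9 * 1 := by ring
        _ < 9 * ((2 + Real.sqrt 3) / 9 * C) := h9
        _ = C * (2 + Real.sqrt 3) := by ring

end QuarterLawExponent

end Summit.NavierStokesRegularity.NavierStokesRegularity.Theorems

end
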